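import Summits.AtomisticToContinuum.HydrodynamicLimit.Theorems.BoxDissipativeWeakStrongRelativeEnergyStabilityDefs
import Summits.AtomisticToContinuum.HydrodynamicLimit.Theorems.JParityClosureParityInBandBridge
import Literature.Analysis.FluidPDE.ClassicalEulerTestFunctions
import HarnessLib

/-!
# Crux `RelativeEnergyStability` (stmt-AtomisticToContinuum-17653), line `registered`: stub `stub_clampChoice`

**S0 — admissible deep clamps exist.** Given the low-density equation-of-state fact `HsEosLowDensity`
(`hsExcessFreeEnergy = F` analytic on `[0, η₀)`), for every band `0 < η₁ < η₀`, every `σ > 0`, every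
classical hard-sphere Euler solution `(ρ, u, θ)` on `[0,T)` obeying the packing guard `ρσ³ ≤ η₁/2` and every
`τ < T`, there are clamps `a < b` that are `ClampAdmissible σ η₁ a b ρ θ τ`: inactive on a uniform `δ`-box
around the strong thermal states on `[0,τ]` (which stays in the band-interior quadrant) and DEEP,
`μ_cut(ρ,θ) + θ a ≤ -1`.

Proof (compactness, Březina–Feireisl 2018 §3.2 choice of the cut-offs): under `HsEosLowDensity` the cut entropy
`s_cut(r,ϑ) = 3/2 log ϑ − log r − F_cut(rσ³)` and the cut Gibbs function `μ_cut` are continuous on the open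
quadrant (`F_cut`, `Z_cut` agree there with expressions in the analytic `F` and `F'`); the thermal range
`K = (ρ,θ)([0,τ] × 𝕋³)` is compact (`IsClassicalEulerSolution.isCompact_range_thermo` through the landed
bridge `isClassicalEulerSolution_of_isHardSphereEulerSolution`) and lies in the open set
`{r > 0, rσ³ < η₁, ϑ > 0}`; a closed
`δ`-thickening of `K` stays inside (`IsCompact.exists_cthickening_subset_open`) and is compact, so `|s_cut| ≤ B`
on it and `(|μ_cut| + 2)/ϑ ≤ A` on `K`; take `b = B + 1`, `a = −(B + 1 + A)`.

References: BrezinaFeireisl2018 §3.2; FeireislNovotny2012.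
-/

noncomputable section

namespace Summit.AtomisticToContinuum.HydrodynamicLimit.Theorems.RES

open MeasureTheory Filter Set Metric
open scoped Topology
open Summit.AtomisticToContinuum.HydrodynamicLimit.Theses.BoxDissipativeWeakStrong
open Literature.MathematicalPhysics.KineticTheory Literature.Analysis.FluidPDE
open Literature.Analysis.FluidPDE.CompressibleEuler

/-! ## Unfolding the cut law -/

/-- The cut entropy unfolded: `s_cut(r,ϑ) = 3/2 log ϑ − log r − F_cut(rσ³)`. -/
theorem cc_s_eq (σ η₁ r ϑ : ℝ) :
    (cutEOS σ η₁).s r ϑ = 3 / 2 * Real.log ϑ - Real.log r - cutExcessFreeEnergy η₁ (r * σ ^ 3) := rfl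

/-- The cut Gibbs function unfolded: `μ_cut(r,Θ) = 3Θ/2 − Θ s_cut(r,Θ) + rΘZ_cut(rσ³)/r`. -/
theorem cc_chemPotential_eq (σ η₁ r Θ : ℝ) :
    (cutEOS σ η₁).chemPotential r Θ =
      3 / 2 * Θ - Θ * (cutEOS σ η₁).s r Θ + r * Θ * cutCompressibility η₁ (r * σ ^ 3) / r := rfl

/-! ## Continuity of the cut law on the open quadrant under `HsEosLowDensity` -/

/-- Under the EOS fact, `F_cut` is continuous on `(0,∞)`: there it is
`F(min η η₁) + (Z(η₁) − 1) log(max η η₁/η₁)`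
with `F` analytic on `(−η₀, η₀) ∋ min η η₁`. -/
theorem cc_continuousOn_cutExcessFreeEnergy {η₀ η₁ : ℝ} {F : ℝ → ℝ}
    (hF : AnalyticOnNhd ℝ F (Ioo (-η₀) η₀)) (hEq : EqOn hsExcessFreeEnergy F (Ico 0 η₀))
    (hη₁ : 0 < η₁) (hη₁₀ : η₁ < η₀) :
    ContinuousOn (cutExcessFreeEnergy η₁) (Ioi 0) := by
  have hmaps : MapsTo (fun η : ℝ => min η η₁) (Ioi 0) (Ioo (-η₀) η₀) := fun η hη =>
    ⟨by have : (0 : ℝ) < min η η₁ := lt_min hη hη₁; linarith, (min_le_right _ _).trans_lt hη₁₀⟩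
  have hFmin : ContinuousOn (fun η : ℝ => F (min η η₁)) (Ioi 0) :=
    hF.continuousOn.comp (continuous_id.min continuous_const).continuousOn hmaps
  have hlog : ContinuousOn (fun η : ℝ => Real.log (max η η₁ / η₁)) (Ioi 0) :=
    ((continuous_id.max continuous_const).continuousOn.div_const _).log fun η _ =>
      ne_of_gt (div_pos (lt_of_lt_of_le hη₁ (le_max_right _ _)) hη₁)
  have hmain : ContinuousOn
      (fun η : ℝ => F (min η η₁) + (hsCompressibility η₁ - 1) * Real.log (max η η₁ / η₁)) (Ioi 0) :=
    hFmin.add (continuousOn_const.mul hlog)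
  refine hmain.congr fun η hη => ?_
  have hmem : min η η₁ ∈ Ico 0 η₀ :=
    ⟨(lt_min (show (0 : ℝ) < η from hη) hη₁).le, (min_le_right _ _).trans_lt hη₁₀⟩
  simp only [cutExcessFreeEnergy, hEq hmem]

/-- Under the EOS fact, `Z_cut` is continuous on `(0,∞)`: there `f_ex' (min η η₁) = F'(min η η₁)`
(`hsExcessFreeEnergy = F` on the open `(0, η₀) ∋ min η η₁`) with `F'` analytic. -/
theorem cc_continuousOn_cutCompressibility {η₀ η₁ : ℝ} {F : ℝ → ℝ}
    (hF : AnalyticOnNhd ℝ F (Ioo (-η₀) η₀)) (hEq : EqOn hsExcessFreeEnergy F (Ico 0 η₀))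
    (hη₁ : 0 < η₁) (hη₁₀ : η₁ < η₀) :
    ContinuousOn (cutCompressibility η₁) (Ioi 0) := by
  have hmaps : MapsTo (fun η : ℝ => min η η₁) (Ioi 0) (Ioo (-η₀) η₀) := fun η hη =>
    ⟨by have : (0 : ℝ) < min η η₁ := lt_min hη hη₁; linarith, (min_le_right _ _).trans_lt hη₁₀⟩
  have hF'min : ContinuousOn (fun η : ℝ => deriv F (min η η₁)) (Ioi 0) :=
    hF.deriv.continuousOn.comp (continuous_id.min continuous_const).continuousOn hmaps
  have hmain : ContinuousOn (fun η : ℝ => 1 + min η η₁ * deriv F (min η η₁)) (Ioi 0) :=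
    continuousOn_const.add ((continuous_id.min continuous_const).continuousOn.mul hF'min)
  refine hmain.congr fun η hη => ?_
  have hpos : (0 : ℝ) < min η η₁ := lt_min hη hη₁
  have hlt : min η η₁ < η₀ := (min_le_right _ _).trans_lt hη₁₀
  have hev : hsExcessFreeEnergy =ᶠ[𝓝 (min η η₁)] F :=
    (hEq.mono Ioo_subset_Ico_self).eventuallyEq_of_mem (Ioo_mem_nhds hpos hlt)
  simp only [cutCompressibility, hsCompressibility, hev.deriv_eq]

/-- Under the EOS fact, the cut entropy `(r,ϑ) ↦ s_cut(r,ϑ)` is continuous on the open quadrant. -/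
theorem cc_continuousOn_s {η₀ η₁ σ : ℝ} {F : ℝ → ℝ}
    (hF : AnalyticOnNhd ℝ F (Ioo (-η₀) η₀)) (hEq : EqOn hsExcessFreeEnergy F (Ico 0 η₀))
    (hη₁ : 0 < η₁) (hη₁₀ : η₁ < η₀) (hσ : 0 < σ) :
    ContinuousOn (fun q : ℝ × ℝ => (cutEOS σ η₁).s q.1 q.2) (Ioi 0 ×ˢ Ioi 0) := by
  have h1 : ContinuousOn (fun q : ℝ × ℝ => Real.log q.2) (Ioi 0 ×ˢ Ioi 0) :=
    continuousOn_snd.log fun q hq => ne_of_gt hq.2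
  have h2 : ContinuousOn (fun q : ℝ × ℝ => Real.log q.1) (Ioi 0 ×ˢ Ioi 0) :=
    continuousOn_fst.log fun q hq => ne_of_gt hq.1
  have h3 : ContinuousOn (fun q : ℝ × ℝ => cutExcessFreeEnergy η₁ (q.1 * σ ^ 3)) (Ioi 0 ×ˢ Ioi 0) :=
    (cc_continuousOn_cutExcessFreeEnergy hF hEq hη₁ hη₁₀).comp (continuousOn_fst.mul continuousOn_const)
      fun q hq => mul_pos hq.1 (pow_pos hσ 3)
  simp only [cc_s_eq]
  exact ((continuousOn_const.mul h1).sub h2).sub h3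

/-- Under the EOS fact, the cut Gibbs function `(r,Θ) ↦ μ_cut(r,Θ)` is continuous on the open quadrant. -/
theorem cc_continuousOn_chemPotential {η₀ η₁ σ : ℝ} {F : ℝ → ℝ}
    (hF : AnalyticOnNhd ℝ F (Ioo (-η₀) η₀)) (hEq : EqOn hsExcessFreeEnergy F (Ico 0 η₀))
    (hη₁ : 0 < η₁) (hη₁₀ : η₁ < η₀) (hσ : 0 < σ) :
    ContinuousOn (fun q : ℝ × ℝ => (cutEOS σ η₁).chemPotential q.1 q.2) (Ioi 0 ×ˢ Ioi 0) := by
  have hs := cc_continuousOn_s hF hEq hη₁ hη₁₀ hσ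
  have hZ : ContinuousOn (fun q : ℝ × ℝ => cutCompressibility η₁ (q.1 * σ ^ 3)) (Ioi 0 ×ˢ Ioi 0) :=
    (cc_continuousOn_cutCompressibility hF hEq hη₁ hη₁₀).comp (continuousOn_fst.mul continuousOn_const)
      fun q hq => mul_pos hq.1 (pow_pos hσ 3)
  simp only [cc_chemPotential_eq]
  exact ((continuousOn_const.mul continuousOn_snd).sub (continuousOn_snd.mul hs)).add
    (((continuousOn_fst.mul continuousOn_snd).mul hZ).div continuousOn_fst fun q hq => ne_of_gt hq.1)

/-! ## Clamps for a compact set of reference states -/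

/-- **Deep inactive clamps around a compact set.** If `s_cut` and `μ_cut` are continuous on the open quadrant and
`K` is a compact subset of the open band-interior quadrant `{r > 0, rσ³ < η₁, ϑ > 0}`, then there are `a < b`
and `δ > 0` with: the closed `δ`-box around every point of `K` lies in the band-interior quadrant and on it
`a < s_cut < b`; and `μ_cut(r,Θ) + Θ a ≤ −1` on `K`. -/
theorem cc_clamps_of_isCompact {σ η₁ : ℝ}
    (hsC : ContinuousOn (fun q : ℝ × ℝ => (cutEOS σ η₁).s q.1 q.2) (Ioi 0 ×ˢ Ioi 0))
    (hμC : ContinuousOn (fun q : ℝ × ℝ => (cutEOS σ η₁).chemPotential q.1 q.2) (Ioi 0 ×ˢ Ioi 0))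
    {K : Set (ℝ × ℝ)} (hK : IsCompact K)
    (hKU : K ⊆ {q : ℝ × ℝ | 0 < q.1 ∧ q.1 * σ ^ 3 < η₁ ∧ 0 < q.2}) :
    ∃ a b δ : ℝ, a < b ∧ 0 < δ ∧
      (∀ r Θ r' ϑ' : ℝ, (r, Θ) ∈ K → |r' - r| ≤ δ → |ϑ' - Θ| ≤ δ →
        0 < r' ∧ 0 < ϑ' ∧ r' * σ ^ 3 < η₁ ∧
          a < (cutEOS σ η₁).s r' ϑ' ∧ (cutEOS σ η₁).s r' ϑ' < b) ∧
      (∀ r Θ : ℝ, (r, Θ) ∈ K → (cutEOS σ η₁).chemPotential r Θ + Θ * a ≤ -1) := by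
  have hU : IsOpen {q : ℝ × ℝ | 0 < q.1 ∧ q.1 * σ ^ 3 < η₁ ∧ 0 < q.2} :=
    (isOpen_lt continuous_const continuous_fst).inter
      ((isOpen_lt (continuous_fst.mul continuous_const) continuous_const).inter
        (isOpen_lt continuous_const continuous_snd))
  have hKq : K ⊆ Ioi 0 ×ˢ Ioi 0 := fun q hq => ⟨(hKU hq).1, (hKU hq).2.2⟩
  obtain ⟨δ, hδ, hK'U⟩ := hK.exists_cthickening_subset_open hU hKU
  have hK'c : IsCompact (cthickening δ K) := hK.cthickening
  have hK'q : cthickening δ K ⊆ Ioi 0 ×ˢ Ioi 0 := fun q hq => ⟨(hK'U hq).1, (hK'U hq).2.2⟩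
  obtain ⟨B, hB0, hB⟩ := EulerEOS.exists_nonneg_forall_abs_le_of_continuousOn hK'c (hsC.mono hK'q)
  have hgC : ContinuousOn
      (fun q : ℝ × ℝ => (|(cutEOS σ η₁).chemPotential q.1 q.2| + 2) / q.2) K :=
    (((hμC.mono hKq).abs).add continuousOn_const).div continuousOn_snd fun q hq => ne_of_gt (hKq hq).2
  obtain ⟨A, hA0, hA⟩ := EulerEOS.exists_nonneg_forall_abs_le_of_continuousOn hK hgC
  refine ⟨-(B + 1 + A), B + 1, δ, by linarith, hδ, ?_, ?_⟩
  · intro r Θ r' ϑ' hmem hr hϑ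
    have hmem' : (r', ϑ') ∈ cthickening δ K := EulerEOS.mem_cthickening_of_abs_le hmem hr hϑ
    have hq := hK'U hmem'
    have hs := abs_le.1 (hB _ hmem')
    exact ⟨hq.1, hq.2.2, hq.2.1, by linarith [hs.1], by linarith [hs.2]⟩
  · intro r Θ hmem
    have hΘ : 0 < Θ := (hKq hmem).2
    have hAq : (|(cutEOS σ η₁).chemPotential r Θ| + 2) / Θ ≤ A := (abs_le.1 (hA _ hmem)).2
    rw [div_le_iff₀ hΘ] at hAq
    linarith [le_abs_self ((cutEOS σ η₁).chemPotential r Θ), mul_nonneg hΘ.le hB0, hΘ.le]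

/-! ## The stub -/

/-- **S0 — admissible deep clamps exist (size S–M, compactness).** Under `HsEosLowDensity` (threshold `η₀`),
for every band `0 < η₁ < η₀`, every `σ > 0`, every classical hard-sphere Euler solution on `[0,T)` with the
packing guard `ρσ³ ≤ η₁/2`, and every `τ ∈ [0,T)`, some clamps `a < b` are
`ClampAdmissible σ η₁ a b ρ θ τ`. Proof: `cc_clamps_of_isCompact` on the compact thermal range
`(ρ,θ)([0,τ] × 𝕋³) ⊂ {r > 0, rσ³ < η₁, ϑ > 0}`,
with the continuity of `s_cut`, `μ_cut` supplied by the EOS fact. -/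
theorem stub_clampChoice :
    HsEosLowDensity →
      ∃ ηe : ℝ, 0 < ηe ∧ ∀ η₁ : ℝ, 0 < η₁ → η₁ < ηe → ∀ σ : ℝ, 0 < σ →
        ∀ (T : ℝ) (ρ θ : ℝ → T3 → ℝ) (u : ℝ → T3 → V3), IsHardSphereEulerSolution σ T ρ u θ →
          (∀ t ∈ Ico 0 T, ∀ x, ρ t x * σ ^ 3 ≤ η₁ / 2) →
          ∀ τ ∈ Ico 0 T, ∃ a b : ℝ, ClampAdmissible σ η₁ a b ρ θ τ := by
  rintro ⟨η₀, hη₀, F, hF, hEq, -, -, -⟩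
  refine ⟨η₀, hη₀, fun η₁ hη₁ hη₁₀ σ hσ T ρ θ u hsol hguard τ hτ => ?_⟩
  have hsC := cc_continuousOn_s hF hEq hη₁ hη₁₀ hσ
  have hμC := cc_continuousOn_chemPotential hF hEq hη₁ hη₁₀ hσ
  obtain ⟨hK, -⟩ :=
    (isClassicalEulerSolution_of_isHardSphereEulerSolution hsol).isCompact_range_thermo hτ.2
  have hKU : (fun z : ℝ × UnitAddTorus (Fin 3) => (ρ z.1 z.2, θ z.1 z.2)) '' (Icc 0 τ ×ˢ univ) ⊆
      {q : ℝ × ℝ | 0 < q.1 ∧ q.1 * σ ^ 3 < η₁ ∧ 0 < q.2} := by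
    rintro q ⟨⟨t, x⟩, ⟨ht, -⟩, rfl⟩
    have htT : t ∈ Ico 0 T := ⟨ht.1, lt_of_le_of_lt ht.2 hτ.2⟩
    exact ⟨hsol.density_pos t htT x, by linarith [hguard t htT x], hsol.temperature_pos t htT x⟩
  obtain ⟨a, b, δ, hab, hδ, hbox, hdeep⟩ := cc_clamps_of_isCompact hsC hμC hK hKU
  have hmem : ∀ t ∈ Icc 0 τ, ∀ x : T3, (ρ t x, θ t x) ∈
      (fun z : ℝ × UnitAddTorus (Fin 3) => (ρ z.1 z.2, θ z.1 z.2)) '' (Icc 0 τ ×ˢ univ) :=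
    fun t ht x => mem_image_of_mem _ (mk_mem_prod ht (mem_univ x))
  exact ⟨a, b, hab, ⟨δ, hδ, fun t ht x r' ϑ' hr hϑ => hbox _ _ r' ϑ' (hmem t ht x) hr hϑ⟩,
    fun t ht x => hdeep _ _ (hmem t ht x)⟩

end Summit.AtomisticToContinuum.HydrodynamicLimit.Theorems.RES

end
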